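import Mathlib
import Summits.MatrixMultiplication.MatrixMultiplication.Theorems.LevelGradedCohnUmansGradedDesignFamilyStubFrameStructure

/-!
# The real level-one (frame) space of `GL₂(K)` has dimension `≤ Q³ + Q²`
# (crux `LevelGradedCohnUmans.GradedDesignFamily`, stmt-MatrixMultiplication-7610; negative side,
# line `quadratic-extension-level-one-cell`, stub `gl2Flat_real_frame_dim`)

For a finite field `K` (`Q = |K|`) consider the `Q⁴` real indicator functions
`ind_(u,w) : GL₂(K) → ℝ`, `g ↦ [g·u = w]` (`(u, w) ∈ K² × K²`).  We prove

* `gl2Flat_real_frame_dim` — the real span of the `ind_(u,w)` has dimension `≤ Q³ + Q²`.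

This is the real-coefficient twin of the complex spanning statement S2(i)
(`GradedDesignFamily.frameStructure_exists_spanning` of
`Theorems/LevelGradedCohnUmansGradedDesignFamilyStubFrameStructure.lean`), whose field-agnostic
ingredients `frameStructure_card_reps_le` and `frameStructure_exists_smul_eq` we reuse.

Proof: let `Reps = {(1,0)} ∪ {(t,1) : t ∈ K}` be the `≤ Q + 1` line representatives
(`frameStructure_card_reps_le`); every `u ≠ 0` is `t • r` with `r ∈ Reps`, `t ≠ 0`
(`frameStructure_exists_smul_eq`).  Put `B = {ind_(r,v) : r ∈ Reps, v ∈ K²}`, a finset of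
`≤ (Q + 1)·Q² = Q³ + Q²` functions (`Finset.card_image_le`, `Finset.card_product`,
`Fintype.card_fun`).  Every indicator `ind_(u,w)` lies in `span B`: for `u = 0` one has `g·0 = 0`,
so `ind_(0,w)` is the zero function (`w ≠ 0`) or the constant `1 = ∑_v ind_(r₀,v)` (`w = 0`, any
`r₀ ∈ Reps`: for each `g` exactly one `v`, namely `g·r₀`, contributes); for `u = t • r` one has
`[g·(t • r) = w] = [g·r = t⁻¹ • w]`, an element of `B`.  Hence `span (range ind) ≤ span B`
(`Submodule.span_le`) and `finrank (span (range ind)) ≤ finrank (span B) ≤ |B| ≤ Q³ + Q²`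
(`Submodule.finrank_mono`, `finrank_span_finset_le_card`).

Sorry-free; axioms `propext`, `Classical.choice`, `Quot.sound`.
-/

set_option linter.dupNamespace false

open scoped BigOperators

namespace Summit.MatrixMultiplication.MatrixMultiplication.Theorems.GradedDesignFamily.Negative

section GL2

variable {K : Type} [Field K] [Fintype K] [DecidableEq K]

-- adapted from Theorems/LevelGradedCohnUmansGradedDesignFamilyStubFrameStructure.lean
-- (`frameStructure_one_mem`, `frameStructure_ind_mem`, `frameStructure_exists_spanning`), `ℂ ↦ ℝ`.

/-- The constant function `1 = ∑_{v} [g·r₀ = v]` lies in any real submodule containing the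
indicators `[g·r₀ = v]`, `v ∈ K²`. [folklore] -/
theorem gl2Flat_real_frame_dim_one_mem
    {S : Submodule ℝ (Matrix.GeneralLinearGroup (Fin 2) K → ℝ)} {r₀ : Fin 2 → K}
    (hS : ∀ v : Fin 2 → K, (fun g : Matrix.GeneralLinearGroup (Fin 2) K =>
      if (g : Matrix (Fin 2) (Fin 2) K).mulVec r₀ = v then (1 : ℝ) else 0) ∈ S) :
    (fun _ : Matrix.GeneralLinearGroup (Fin 2) K => (1 : ℝ)) ∈ S := by
  have h : (fun _ : Matrix.GeneralLinearGroup (Fin 2) K => (1 : ℝ)) =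
      ∑ v : Fin 2 → K, fun g : Matrix.GeneralLinearGroup (Fin 2) K =>
        if (g : Matrix (Fin 2) (Fin 2) K).mulVec r₀ = v then (1 : ℝ) else 0 := by
    funext g
    rw [Finset.sum_apply, Finset.sum_ite_eq, if_pos (Finset.mem_univ _)]
  rw [h]
  exact Submodule.sum_mem _ fun v _ => hS v

/-- Every indicator `[g·u = v]` lies in a real submodule `S` containing the indicators at a
non-empty set `Reps` of line representatives covering `K² ∖ {0}` by non-zero scalars: for `u = 0`
it is `0` or the constant `1`; for `u = t • r` (`r ∈ Reps`, `t ≠ 0`) it is `[g·r = t⁻¹ • v]`.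
[folklore] -/
theorem gl2Flat_real_frame_dim_ind_mem
    {S : Submodule ℝ (Matrix.GeneralLinearGroup (Fin 2) K → ℝ)}
    {Reps : Finset (Fin 2 → K)} (hne : Reps.Nonempty)
    (hcov : ∀ u : Fin 2 → K, u ≠ 0 → ∃ r ∈ Reps, ∃ t : K, t ≠ 0 ∧ t • r = u)
    (hS : ∀ r ∈ Reps, ∀ v : Fin 2 → K, (fun g : Matrix.GeneralLinearGroup (Fin 2) K =>
      if (g : Matrix (Fin 2) (Fin 2) K).mulVec r = v then (1 : ℝ) else 0) ∈ S)
    (u v : Fin 2 → K) :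
    (fun g : Matrix.GeneralLinearGroup (Fin 2) K =>
      if (g : Matrix (Fin 2) (Fin 2) K).mulVec u = v then (1 : ℝ) else 0) ∈ S := by
  by_cases hu : u = 0
  · subst hu
    by_cases hv : v = 0
    · subst hv
      have h : (fun g : Matrix.GeneralLinearGroup (Fin 2) K =>
          if (g : Matrix (Fin 2) (Fin 2) K).mulVec (0 : Fin 2 → K) = 0 then (1 : ℝ) else 0) =
          fun _ : Matrix.GeneralLinearGroup (Fin 2) K => (1 : ℝ) := by
        funext g
        rw [Matrix.mulVec_zero, if_pos rfl]
      rw [h]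
      obtain ⟨r₀, hr₀⟩ := hne
      exact gl2Flat_real_frame_dim_one_mem (hS r₀ hr₀)
    · have h : (fun g : Matrix.GeneralLinearGroup (Fin 2) K =>
          if (g : Matrix (Fin 2) (Fin 2) K).mulVec (0 : Fin 2 → K) = v then (1 : ℝ) else 0) =
          0 := by
        funext g
        rw [Matrix.mulVec_zero, if_neg (Ne.symm hv), Pi.zero_apply]
      rw [h]
      exact Submodule.zero_mem _
  · obtain ⟨r, hr, t, ht, rfl⟩ := hcov u hu
    have h : (fun g : Matrix.GeneralLinearGroup (Fin 2) K =>
        if (g : Matrix (Fin 2) (Fin 2) K).mulVec (t • r) = v then (1 : ℝ) else 0) =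
        fun g : Matrix.GeneralLinearGroup (Fin 2) K =>
          if (g : Matrix (Fin 2) (Fin 2) K).mulVec r = t⁻¹ • v then (1 : ℝ) else 0 := by
      funext g
      rw [Matrix.mulVec_smul]
      exact if_congr (eq_inv_smul_iff₀ ht).symm rfl rfl
    rw [h]
    exact hS r hr _

end GL2

/-- **A real spanning set of size `≤ |K|³ + |K|²`**: the indicators `[g·r = v]` (`r` a line
representative `(1,0)` or `(t,1)`, `v ∈ K²`) form a finset of at most `|K|³ + |K|²` real functions
on `GL₂(K)` whose span contains every indicator `[g·u = v]` (`u, v ∈ K²`). [folklore] -/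
theorem gl2Flat_real_frame_dim_exists_spanning (K : Type) [Field K] [Fintype K] [DecidableEq K] :
    ∃ B : Finset (Matrix.GeneralLinearGroup (Fin 2) K → ℝ),
      B.card ≤ Fintype.card K ^ 3 + Fintype.card K ^ 2 ∧
      ∀ u v : Fin 2 → K, (fun g : Matrix.GeneralLinearGroup (Fin 2) K =>
          if (g : Matrix (Fin 2) (Fin 2) K).mulVec u = v then (1 : ℝ) else 0) ∈
        Submodule.span ℝ (B : Set (Matrix.GeneralLinearGroup (Fin 2) K → ℝ)) := by
  refine ⟨(insert (![1, 0] : Fin 2 → K) (Finset.univ.image fun t : K => ![t, 1]) ×ˢ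
      (Finset.univ : Finset (Fin 2 → K))).image
    fun rv => fun g : Matrix.GeneralLinearGroup (Fin 2) K =>
      if (g : Matrix (Fin 2) (Fin 2) K).mulVec rv.1 = rv.2 then (1 : ℝ) else 0, ?_, fun u v => ?_⟩
  · -- `|B| ≤ |Reps| · |K|² ≤ (|K| + 1) · |K|²`
    refine Finset.card_image_le.trans ?_
    rw [Finset.card_product, Finset.card_univ, Fintype.card_fun, Fintype.card_fin]
    calc (insert (![1, 0] : Fin 2 → K) (Finset.univ.image fun t : K => ![t, 1])).card *
          Fintype.card K ^ 2
        ≤ (Fintype.card K + 1) * Fintype.card K ^ 2 :=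
          Nat.mul_le_mul_right _ (frameStructure_card_reps_le K)
      _ = Fintype.card K ^ 3 + Fintype.card K ^ 2 := by ring
  · -- every indicator lies in the span of `B`
    exact gl2Flat_real_frame_dim_ind_mem (Finset.insert_nonempty _ _)
      (fun u hu => frameStructure_exists_smul_eq hu)
      (fun r hr v => Submodule.subset_span (Finset.mem_coe.2 (Finset.mem_image_of_mem _
        (Finset.mk_mem_product hr (Finset.mem_univ v))))) u v

/-- **B3 `gl2Flat_real_frame_dim`** (registered stub of line `quadratic-extension-level-one-cell`,
crux `LevelGradedCohnUmans.GradedDesignFamily`).  For every finite field `K` (`Q = |K|`), the real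
span of the `Q⁴` level-one indicator functions `g ↦ [g·u = w]` on `GL₂(K)` (`(u, w) ∈ K² × K²`)
has dimension at most `Q³ + Q²`: it is contained in the span of the `≤ (Q + 1)·Q²` indicators at
the line representatives (`gl2Flat_real_frame_dim_exists_spanning`). [folklore] -/
theorem gl2Flat_real_frame_dim : ∀ (K : Type) [Field K] [Fintype K] [DecidableEq K],
    Module.finrank ℝ (Submodule.span ℝ (Set.range fun p : (Fin 2 → K) × (Fin 2 → K) =>
      fun g : Matrix.GeneralLinearGroup (Fin 2) K =>
        if (g : Matrix (Fin 2) (Fin 2) K).mulVec p.1 = p.2 then (1 : ℝ) else 0)) ≤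
      Fintype.card K ^ 3 + Fintype.card K ^ 2 := by
  intro K _ _ _
  obtain ⟨B, hB, hmem⟩ := gl2Flat_real_frame_dim_exists_spanning K
  have hle : Submodule.span ℝ (Set.range fun p : (Fin 2 → K) × (Fin 2 → K) =>
      fun g : Matrix.GeneralLinearGroup (Fin 2) K =>
        if (g : Matrix (Fin 2) (Fin 2) K).mulVec p.1 = p.2 then (1 : ℝ) else 0) ≤
      Submodule.span ℝ (B : Set (Matrix.GeneralLinearGroup (Fin 2) K → ℝ)) :=
    Submodule.span_le.2 (Set.range_subset_iff.2 fun p => hmem p.1 p.2)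
  exact (Submodule.finrank_mono hle).trans ((finrank_span_finset_le_card B).trans hB)

end Summit.MatrixMultiplication.MatrixMultiplication.Theorems.GradedDesignFamily.Negative
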